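import Summits.CriticalPhenomena.PercolationContinuityZ3.Theorems.SahiMasterFamilyFCrossInductionAB
import Mathlib.Tactic.Linarith
import Mathlib.Tactic.Ring
import HarnessLib

/-!
# The `F`-inequality holds whenever the third event lies inside the union of the first two

Support file (cell `prim-bnk`, seat bnk-2 gen 19; `--supports stmt-CriticalPhenomena-4575`; memo
`run/shared/lean/prim/prim-l12/FROM-prim-bnk-2-g19-F-UNION-CLASS.md`).  No definition, no `sorry`, standard axioms.

Recall (`prim-master-conj` gen 20/21) the conjectured inequality for increasing events `A, B, G` under a product measure,
`F(A,B;G) := (1 + μG)·μ(A∩B∩G) − μG·μ(A∩B) − μ(A∩G)·μ(B∩G) ≥ 0` (OPEN in general), and its one-coordinate Bernstein form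
`F = (1−t)²·F⁰ + t²·F¹ + t(1−t)·X_e` (`SahiFInduction.F_bernstein_secAt`).  THIS FILE PROVES

**THEOREM.  `F(A,B;G) ≥ 0` for all increasing `A, B, G` with `G ⊆ A ∪ B`, on every finite cube and for every product measure**
(`F_nonneg_of_third_subset_union`).  Equivalently (paper restatement, with `C = A∩G`, `D = B∩G`, `G = C ∪ D`): for all increasing
`C, D`,  `Cov(C,D) ≥ μ(C∪D)·μ{ω ∉ C∪D : every ω' ≥ ω in C∪D lies in C∩D}` — a quantitative Harris inequality; it contains every tight
case of the conjecture (`C = D`, and independent `C, D`) and the case `G ⊇ A ∪ B` (`F = Cov(A,B)`).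

PROOF (new).  With `a^b = μ(A^bG^b)`, `b^b = μ(B^bG^b)`, `g^b = μG^b`, `r^b = μ(A^bB^b) − μ(A^bB^bG^b)` (sections along `e`) one has the
exact identity `X_e − F⁰ − F¹ = (a¹−a⁰)(b¹−b⁰) + (g¹−g⁰)(r¹−r⁰)` (`cross_sub_sections_eq`).  Put `s = μ(A⁰B⁰G¹) − μ(A⁰B⁰G⁰)` (the
residual mass of level `0` swallowed by `G` at level `1`) and `w = (g¹−g⁰) − s`.  Elementary inclusions give `r¹ − r⁰ ≥ −s`,
`a¹ − a⁰ ≥ s + w_C`, `b¹ − b⁰ ≥ s + w_D` with `w_C = a¹ − μ(A¹G⁰) − s ≥ 0`, `w_D = b¹ − μ(B¹G⁰) − s ≥ 0`, and — the only place where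
`G ⊆ A ∪ B` is used — `w_C + w_D ≥ w` (every point of `G¹ ∖ G⁰` lies in `A¹ ∪ B¹`).  Hence
`X_e − F⁰ − F¹ ≥ (s+w_C)(s+w_D) − (s+w)s ≥ 0`, i.e. **`X_e ≥ F⁰ + F¹` along EVERY coordinate** (`cross_ge_sections_of_third_subset_union`),
and since the class `G ⊆ A ∪ B` is closed under sections, `F ≥ (1−t)F⁰ + tF¹ ≥ 0` by induction on the total essential support.
For a general third event the same computation leaves exactly one signed term, `−s·μ(W₀)` with `W₀ = (G¹∖G⁰) ∖ (A¹∪B¹)` the "new bare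
points" — recorded in the memo as the remaining obstruction.  HONEST FRAMING: a theorem for the class `G ⊆ A ∪ B`; `F ≥ 0` in general
remains OPEN. [this work]
-/

noncomputable section

open scoped Classical

namespace Summit.CriticalPhenomena.PercolationContinuityZ3.Theorems

namespace SahiFInduction

open Finset Function
open Literature.Combinatorics.Sahi2008
open Literature.Probability.Percolation.DecisionTree (ind ind_of_mem ind_of_not_mem ind_nonneg)
open Literature.Probability.Percolation.BHK2006 (weight_nonneg)

variable {κ : Type} [Fintype κ]

local notation3 (prettyPrint := false) "μ⟦" p ", " X "⟧" => ex (bernoulliWeight p) (ind X)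

/-! ### 0. Plumbing -/

/-- Monotonicity of `μ_p` under inclusion. [folklore] -/
private theorem mu_mono (p : κ → unitInterval) {X Y : Set (Set κ)} (h : X ⊆ Y) : μ⟦p, X⟧ ≤ μ⟦p, Y⟧ := by
  refine ex_mono (fun ω => weight_nonneg (fun i => (p i).2.1) (fun i => (p i).2.2) ω) (fun ω => ?_)
  by_cases hx : ω ∈ X
  · rw [ind_of_mem hx, ind_of_mem (h hx)]
  · rw [ind_of_not_mem hx]; exact ind_nonneg Y ω

/-- Four-set exchange inequality: for `P ⊆ P'`, `Q ⊆ Q'`, `μ(P∩Q') + μ(P'∩Q) ≤ μ(P'∩Q') + μ(P∩Q)`. [folklore] -/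
private theorem mu_exchange (p : κ → unitInterval) {P P' Q Q' : Set (Set κ)} (hP : P ⊆ P') (hQ : Q ⊆ Q') :
    μ⟦p, P ∩ Q'⟧ + μ⟦p, P' ∩ Q⟧ ≤ μ⟦p, P' ∩ Q'⟧ + μ⟦p, P ∩ Q⟧ := by
  rw [← ex_add, ← ex_add]
  refine ex_mono (fun ω => weight_nonneg (fun i => (p i).2.1) (fun i => (p i).2.2) ω) (fun ω => ?_)
  simp only [Pi.add_apply]
  by_cases hPω : ω ∈ P
  · have hP'ω : ω ∈ P' := hP hPω
    by_cases hQ'ω : ω ∈ Q'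
    · rw [ind_of_mem (show ω ∈ P ∩ Q' from ⟨hPω, hQ'ω⟩), ind_of_mem (show ω ∈ P' ∩ Q' from ⟨hP'ω, hQ'ω⟩)]
      by_cases hQω : ω ∈ Q
      · rw [ind_of_mem (show ω ∈ P' ∩ Q from ⟨hP'ω, hQω⟩), ind_of_mem (show ω ∈ P ∩ Q from ⟨hPω, hQω⟩)]
      · rw [ind_of_not_mem (show ω ∉ P' ∩ Q from fun h => hQω h.2), ind_of_not_mem (show ω ∉ P ∩ Q from fun h => hQω h.2)]
    · have hQω : ω ∉ Q := fun h => hQ'ω (hQ h)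
      rw [ind_of_not_mem (show ω ∉ P ∩ Q' from fun h => hQ'ω h.2), ind_of_not_mem (show ω ∉ P' ∩ Q' from fun h => hQ'ω h.2),
        ind_of_not_mem (show ω ∉ P' ∩ Q from fun h => hQω h.2), ind_of_not_mem (show ω ∉ P ∩ Q from fun h => hQω h.2)]
  · rw [ind_of_not_mem (show ω ∉ P ∩ Q' from fun h => hPω h.1), ind_of_not_mem (show ω ∉ P ∩ Q from fun h => hPω h.1),
      zero_add, add_zero]
    by_cases h : ω ∈ P' ∩ Q
    · rw [ind_of_mem h, ind_of_mem (show ω ∈ P' ∩ Q' from ⟨h.1, hQ h.2⟩)]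
    · rw [ind_of_not_mem h]; exact ind_nonneg _ ω

omit [Fintype κ] in
/-- Sections preserve `G ⊆ A ∪ B`. [folklore] -/
theorem secAt_subset_union_of_subset_union (e : κ) (b : Bool) {A B G : Set (Set κ)} (h : G ⊆ A ∪ B) :
    secAt e b G ⊆ secAt e b A ∪ secAt e b B := by
  intro ω hω
  rw [mem_secAt] at hω
  rcases h hω with hA | hB
  · exact Or.inl (mem_secAt.2 hA)
  · exact Or.inr (mem_secAt.2 hB)

/-! ### 1. The cross coefficient minus the two section instances -/

/-- **`X_e − F⁰ − F¹ = Δa·Δb + Δg·Δr`** (pure algebra): with `a^b = μ(A^bG^b)`, `b^b = μ(B^bG^b)`, `g^b = μG^b`,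
`r^b = μ(A^bB^b) − μ(A^bB^bG^b)`, the cross Bernstein coefficient of `F_bernstein_secAt` minus `F(A⁰,B⁰;G⁰) + F(A¹,B¹;G¹)` equals
`(a¹−a⁰)(b¹−b⁰) + (g¹−g⁰)(r¹−r⁰)`. [this work] -/
theorem cross_sub_sections_eq (p : κ → unitInterval) (e : κ) (A B G : Set (Set κ)) :
    (μ⟦p, secAt e true A ∩ secAt e true B ∩ secAt e true G⟧ + μ⟦p, secAt e false A ∩ secAt e false B ∩ secAt e false G⟧
        + μ⟦p, secAt e true G⟧ * μ⟦p, secAt e false A ∩ secAt e false B ∩ secAt e false G⟧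
        + μ⟦p, secAt e false G⟧ * μ⟦p, secAt e true A ∩ secAt e true B ∩ secAt e true G⟧
        - μ⟦p, secAt e true G⟧ * μ⟦p, secAt e false A ∩ secAt e false B⟧
        - μ⟦p, secAt e false G⟧ * μ⟦p, secAt e true A ∩ secAt e true B⟧
        - μ⟦p, secAt e true A ∩ secAt e true G⟧ * μ⟦p, secAt e false B ∩ secAt e false G⟧
        - μ⟦p, secAt e false A ∩ secAt e false G⟧ * μ⟦p, secAt e true B ∩ secAt e true G⟧)
      - ((1 + μ⟦p, secAt e false G⟧) * μ⟦p, secAt e false A ∩ secAt e false B ∩ secAt e false G⟧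
          - μ⟦p, secAt e false G⟧ * μ⟦p, secAt e false A ∩ secAt e false B⟧
          - μ⟦p, secAt e false A ∩ secAt e false G⟧ * μ⟦p, secAt e false B ∩ secAt e false G⟧)
      - ((1 + μ⟦p, secAt e true G⟧) * μ⟦p, secAt e true A ∩ secAt e true B ∩ secAt e true G⟧
          - μ⟦p, secAt e true G⟧ * μ⟦p, secAt e true A ∩ secAt e true B⟧
          - μ⟦p, secAt e true A ∩ secAt e true G⟧ * μ⟦p, secAt e true B ∩ secAt e true G⟧)
      = (μ⟦p, secAt e true A ∩ secAt e true G⟧ - μ⟦p, secAt e false A ∩ secAt e false G⟧)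
          * (μ⟦p, secAt e true B ∩ secAt e true G⟧ - μ⟦p, secAt e false B ∩ secAt e false G⟧)
        + (μ⟦p, secAt e true G⟧ - μ⟦p, secAt e false G⟧)
          * ((μ⟦p, secAt e true A ∩ secAt e true B⟧ - μ⟦p, secAt e true A ∩ secAt e true B ∩ secAt e true G⟧)
            - (μ⟦p, secAt e false A ∩ secAt e false B⟧ - μ⟦p, secAt e false A ∩ secAt e false B ∩ secAt e false G⟧)) := by
  ring

set_option maxHeartbeats 400000 in
/-- **Key step: along every coordinate, `X_e ≥ F(A⁰,B⁰;G⁰) + F(A¹,B¹;G¹)` when `G ⊆ A ∪ B`** (increasing `A, B, G`).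
With `s = μ(A⁰B⁰G¹) − μ(A⁰B⁰G⁰)`, `w = Δg − s`, `w_C = a¹ − μ(A¹G⁰) − s`, `w_D = b¹ − μ(B¹G⁰) − s`: `Δr ≥ −s`, `Δa ≥ s + w_C`,
`Δb ≥ s + w_D`, `w, w_C, w_D ≥ 0` (exchange inequalities) and `w_C + w_D ≥ w` (this is where `G ⊆ A ∪ B` enters), so
`ΔaΔb + ΔgΔr ≥ (s+w_C)(s+w_D) − (s+w)s ≥ 0`. [this work] -/
theorem cross_ge_sections_of_third_subset_union (p : κ → unitInterval) (e : κ) {A B G : Set (Set κ)}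
    (hA : IsUpperSet A) (hB : IsUpperSet B) (hG : IsUpperSet G) (h : G ⊆ A ∪ B) :
    ((1 + μ⟦p, secAt e false G⟧) * μ⟦p, secAt e false A ∩ secAt e false B ∩ secAt e false G⟧
          - μ⟦p, secAt e false G⟧ * μ⟦p, secAt e false A ∩ secAt e false B⟧
          - μ⟦p, secAt e false A ∩ secAt e false G⟧ * μ⟦p, secAt e false B ∩ secAt e false G⟧)
      + ((1 + μ⟦p, secAt e true G⟧) * μ⟦p, secAt e true A ∩ secAt e true B ∩ secAt e true G⟧
          - μ⟦p, secAt e true G⟧ * μ⟦p, secAt e true A ∩ secAt e true B⟧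
          - μ⟦p, secAt e true A ∩ secAt e true G⟧ * μ⟦p, secAt e true B ∩ secAt e true G⟧)
      ≤ μ⟦p, secAt e true A ∩ secAt e true B ∩ secAt e true G⟧ + μ⟦p, secAt e false A ∩ secAt e false B ∩ secAt e false G⟧
        + μ⟦p, secAt e true G⟧ * μ⟦p, secAt e false A ∩ secAt e false B ∩ secAt e false G⟧
        + μ⟦p, secAt e false G⟧ * μ⟦p, secAt e true A ∩ secAt e true B ∩ secAt e true G⟧
        - μ⟦p, secAt e true G⟧ * μ⟦p, secAt e false A ∩ secAt e false B⟧
        - μ⟦p, secAt e false G⟧ * μ⟦p, secAt e true A ∩ secAt e true B⟧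
        - μ⟦p, secAt e true A ∩ secAt e true G⟧ * μ⟦p, secAt e false B ∩ secAt e false G⟧
        - μ⟦p, secAt e false A ∩ secAt e false G⟧ * μ⟦p, secAt e true B ∩ secAt e true G⟧ := by
  have hid := cross_sub_sections_eq p e A B G
  -- nested sections
  have sA := secAt_false_subset_true hA e
  have sB := secAt_false_subset_true hB e
  have sG := secAt_false_subset_true hG e
  have sAB : secAt e false A ∩ secAt e false B ⊆ secAt e true A ∩ secAt e true B := Set.inter_subset_inter sA sB
  -- abbreviations (as real numbers)
  set a0 := μ⟦p, secAt e false A ∩ secAt e false G⟧ with ha0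
  set a1 := μ⟦p, secAt e true A ∩ secAt e true G⟧ with ha1
  set b0 := μ⟦p, secAt e false B ∩ secAt e false G⟧ with hb0
  set b1 := μ⟦p, secAt e true B ∩ secAt e true G⟧ with hb1
  set g0 := μ⟦p, secAt e false G⟧ with hg0
  set g1 := μ⟦p, secAt e true G⟧ with hg1
  set u0 := μ⟦p, secAt e false A ∩ secAt e false B⟧ with hu0
  set u1 := μ⟦p, secAt e true A ∩ secAt e true B⟧ with hu1
  set v0 := μ⟦p, secAt e false A ∩ secAt e false B ∩ secAt e false G⟧ with hv0
  set v1 := μ⟦p, secAt e true A ∩ secAt e true B ∩ secAt e true G⟧ with hv1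
  -- the swallowed mass `s = μ(A⁰B⁰G¹) − μ(A⁰B⁰G⁰)` and the auxiliary moments `μ(A¹G⁰)`, `μ(B¹G⁰)`
  set sv := μ⟦p, secAt e false A ∩ secAt e false B ∩ secAt e true G⟧ with hsv
  set aX := μ⟦p, secAt e true A ∩ secAt e false G⟧ with haX
  set bX := μ⟦p, secAt e true B ∩ secAt e false G⟧ with hbX
  -- (F1) Δr ≥ −s :  u0 + v1·? … precisely  u0 + μ(A¹B¹ ∩ G¹) ≤ u1 + μ(A⁰B⁰ ∩ G¹)
  have F1 := mu_exchange p (P := secAt e false A ∩ secAt e false B) (P' := secAt e true A ∩ secAt e true B)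
    (Q := secAt e true G) (Q' := (Set.univ : Set (Set κ))) sAB (Set.subset_univ _)
  rw [Set.inter_univ, Set.inter_univ] at F1
  -- (F2) w ≥ 0 :  g0 + μ(A⁰B⁰ ∩ G¹) ≤ g1 + μ(A⁰B⁰ ∩ G⁰)   (exchange with P = G⁰ ⊆ G¹, Q = A⁰B⁰ ⊆ univ)
  have F2 := mu_exchange p (P := secAt e false G) (P' := secAt e true G) (Q := secAt e false A ∩ secAt e false B)
    (Q' := (Set.univ : Set (Set κ))) sG (Set.subset_univ _)
  rw [Set.inter_univ, Set.inter_univ, Set.inter_comm (secAt e true G), Set.inter_comm (secAt e false G)] at F2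
  -- (F3) Δa ≥ s + w_C  ⟺  μ(A⁰G⁰) ≤ μ(A¹G⁰) ; (F4) likewise for B
  have F3 : a0 ≤ aX := mu_mono p (Set.inter_subset_inter_left _ sA)
  have F4 : b0 ≤ bX := mu_mono p (Set.inter_subset_inter_left _ sB)
  -- (W_C ≥ 0):  μ(A⁰B⁰ ∩ G¹) + μ(A¹ ∩ G⁰) ≤ μ(A¹ ∩ G¹) + μ(A⁰B⁰ ∩ G⁰)  (exchange, P = A⁰B⁰ ⊆ A¹, Q = G⁰ ⊆ G¹); (W_D ≥ 0) likewise
  have WC := mu_exchange p (P := secAt e false A ∩ secAt e false B) (P' := secAt e true A) (Q := secAt e false G)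
    (Q' := secAt e true G) (fun ω hω => sA hω.1) sG
  have WD := mu_exchange p (P := secAt e false A ∩ secAt e false B) (P' := secAt e true B) (Q := secAt e false G)
    (Q' := secAt e true G) (fun ω hω => sB hω.2) sG
  -- (F5) w_C + w_D ≥ w : the indicator inequality  1_{A¹G¹} + 1_{B¹G¹} + 1_{G⁰} + 1_{A⁰B⁰G⁰} ≥ 1_{A¹G⁰} + 1_{B¹G⁰} + 1_{A⁰B⁰G¹} + 1_{G¹}
  have F5 : aX + bX + sv + g1 ≤ a1 + b1 + g0 + v0 := by
    rw [haX, hbX, hsv, hg1, ha1, hb1, hg0, hv0, ← ex_add, ← ex_add, ← ex_add, ← ex_add, ← ex_add, ← ex_add]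
    refine ex_mono (fun ω => weight_nonneg (fun i => (p i).2.1) (fun i => (p i).2.2) ω) (fun ω => ?_)
    simp only [Pi.add_apply]
    have hG1sub := secAt_subset_union_of_subset_union e true h
    by_cases hG1 : ω ∈ secAt e true G
    · by_cases hG0 : ω ∈ secAt e false G
      · -- ω ∈ G⁰ ⊆ G¹ : both sides are equal
        by_cases hA1 : ω ∈ secAt e true A <;> by_cases hB1 : ω ∈ secAt e true B <;>
          by_cases hA0 : ω ∈ secAt e false A <;> by_cases hB0 : ω ∈ secAt e false B <;>
          simp only [ind, Set.mem_inter_iff, hG1, hG0, hA1, hB1, hA0, hB0, and_self, and_true, and_false,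
            if_true, if_false] <;>
          first
            | exact absurd (sA hA0) hA1
            | exact absurd (sB hB0) hB1
            | norm_num
      · -- ω ∈ G¹ ∖ G⁰ : left side `[A⁰B⁰] + 1`, right side `[A¹] + [B¹]`, and ω ∈ A¹ ∪ B¹ (this is where `G ⊆ A ∪ B` is used)
        have hAB1 : ω ∈ secAt e true A ∨ ω ∈ secAt e true B := hG1sub hG1
        by_cases hA1 : ω ∈ secAt e true A <;> by_cases hB1 : ω ∈ secAt e true B <;>
          by_cases hA0 : ω ∈ secAt e false A <;> by_cases hB0 : ω ∈ secAt e false B <;>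
          simp only [ind, Set.mem_inter_iff, hG1, hG0, hA1, hB1, hA0, hB0, and_self, and_true, and_false,
            if_true, if_false] <;>
          first
            | exact absurd (sA hA0) hA1
            | exact absurd (sB hB0) hB1
            | (exfalso; rcases hAB1 with h' | h' <;> contradiction)
            | norm_num
    · -- ω ∉ G¹ (hence ∉ G⁰): everything vanishes
      have hG0 : ω ∉ secAt e false G := fun hh => hG1 (sG hh)
      simp only [ind, Set.mem_inter_iff, hG1, hG0, and_false, if_false]
      norm_num
  -- nonnegativity of the basic quantities
  have s_nn : 0 ≤ sv - v0 := sub_nonneg.2 (mu_mono p (Set.inter_subset_inter_right _ sG))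
  have dg_nn : 0 ≤ g1 - g0 := sub_nonneg.2 (mu_mono p sG)
  -- assemble:  Δa ≥ s + w_C ≥ 0, Δb ≥ s + w_D ≥ 0, Δg = s + w, Δr ≥ -s, w_C + w_D ≥ w ≥ 0
  --   s := sv - v0,  w := (g1 - g0) - s,  w_C := a1 - aX - s,  w_D := b1 - bX - s
  have wC_nn : 0 ≤ a1 - aX - (sv - v0) := by linarith [WC]
  have wD_nn : 0 ≤ b1 - bX - (sv - v0) := by linarith [WD]
  have w_nn : 0 ≤ (g1 - g0) - (sv - v0) := by linarith [F2]
  have hDa : (sv - v0) + (a1 - aX - (sv - v0)) ≤ a1 - a0 := by linarith [F3]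
  have hDb : (sv - v0) + (b1 - bX - (sv - v0)) ≤ b1 - b0 := by linarith [F4]
  have hDr : -(sv - v0) ≤ (u1 - v1) - (u0 - v0) := by linarith [F1]
  have hW : (g1 - g0) - (sv - v0) ≤ (a1 - aX - (sv - v0)) + (b1 - bX - (sv - v0)) := by linarith [F5]
  -- products
  have P1 : ((sv - v0) + (a1 - aX - (sv - v0))) * ((sv - v0) + (b1 - bX - (sv - v0))) ≤ (a1 - a0) * (b1 - b0) :=
    mul_le_mul hDa hDb (by linarith) (by linarith)
  have P2 : (g1 - g0) * (-(sv - v0)) ≤ (g1 - g0) * ((u1 - v1) - (u0 - v0)) := mul_le_mul_of_nonneg_left hDr dg_nn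
  have P3 : 0 ≤ (sv - v0) * ((a1 - aX - (sv - v0)) + (b1 - bX - (sv - v0)) - ((g1 - g0) - (sv - v0))) :=
    mul_nonneg s_nn (by linarith)
  have P4 : 0 ≤ (a1 - aX - (sv - v0)) * (b1 - bX - (sv - v0)) := mul_nonneg wC_nn wD_nn
  nlinarith [hid, P1, P2, P3, P4]

/-- **THEOREM (the union class).**  For every finite cube, every product weight `p` and all increasing events `A, B, G` with
`G ⊆ A ∪ B`:  `F(A,B;G) = (1 + μG)μ(A∩B∩G) − μG·μ(A∩B) − μ(A∩G)μ(B∩G) ≥ 0`.  (Strong induction on the total essential support: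
the class is closed under sections, the cross coefficient dominates the two section instances along any essential coordinate of
`A` by `cross_ge_sections_of_third_subset_union`, and `F = (1−t)²F⁰ + t²F¹ + t(1−t)X_e ≥ (1−t)F⁰ + tF¹ ≥ 0`; if `A` has no essential
coordinate, `F_nonneg_of_esupp_left_eq_empty`.) [this work] -/
theorem F_nonneg_of_third_subset_union (p : κ → unitInterval) :
    ∀ (A B G : Set (Set κ)), IsUpperSet A → IsUpperSet B → IsUpperSet G → G ⊆ A ∪ B →
      0 ≤ (1 + μ⟦p, G⟧) * μ⟦p, A ∩ B ∩ G⟧ - μ⟦p, G⟧ * μ⟦p, A ∩ B⟧ - μ⟦p, A ∩ G⟧ * μ⟦p, B ∩ G⟧ := by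
  suffices key : ∀ (N : ℕ) (A B G : Set (Set κ)), (esupp A).card + (esupp B).card + (esupp G).card ≤ N →
      IsUpperSet A → IsUpperSet B → IsUpperSet G → G ⊆ A ∪ B →
      0 ≤ (1 + μ⟦p, G⟧) * μ⟦p, A ∩ B ∩ G⟧ - μ⟦p, G⟧ * μ⟦p, A ∩ B⟧ - μ⟦p, A ∩ G⟧ * μ⟦p, B ∩ G⟧ from
    fun A B G hA hB hG h => key _ A B G le_rfl hA hB hG h
  intro N
  induction N with
  | zero =>
    intro A B G hN hA hB hG _
    exact F_nonneg_of_esupp_left_eq_empty p hA hB hG (Finset.card_eq_zero.1 (by omega))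
  | succ N ih =>
    intro A B G hN hA hB hG h
    by_cases hA0 : esupp A = ∅
    · exact F_nonneg_of_esupp_left_eq_empty p hA hB hG hA0
    obtain ⟨e, he⟩ := Finset.nonempty_iff_ne_empty.2 hA0
    -- the sections have smaller total support and stay in the class
    have hlt : ∀ b : Bool, (esupp (secAt e b A)).card + (esupp (secAt e b B)).card + (esupp (secAt e b G)).card ≤ N := by
      intro b
      have lA := SahiClassTCube.card_esupp_secAt_lt hA he b
      have lB := SahiClassTCube.card_esupp_secAt_le hB e b
      have lG := SahiClassTCube.card_esupp_secAt_le hG e b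
      omega
    have hsec : ∀ b : Bool, 0 ≤ (1 + μ⟦p, secAt e b G⟧) * μ⟦p, secAt e b A ∩ secAt e b B ∩ secAt e b G⟧
        - μ⟦p, secAt e b G⟧ * μ⟦p, secAt e b A ∩ secAt e b B⟧ - μ⟦p, secAt e b A ∩ secAt e b G⟧ * μ⟦p, secAt e b B ∩ secAt e b G⟧ :=
      fun b => ih _ _ _ (hlt b) (isUpperSet_secAt e b hA) (isUpperSet_secAt e b hB) (isUpperSet_secAt e b hG)
        (secAt_subset_union_of_subset_union e b h)
    have hX := cross_ge_sections_of_third_subset_union p e hA hB hG h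
    rw [F_bernstein_secAt p e A B G]
    have ht0 : 0 ≤ (p e : ℝ) := (p e).2.1
    have ht1 : 0 ≤ 1 - (p e : ℝ) := sub_nonneg.2 (p e).2.2
    have f0 := hsec false
    have f1 := hsec true
    have a0 := mul_nonneg ht1 f0
    have a1 := mul_nonneg ht0 f1
    have a2 := mul_le_mul_of_nonneg_left hX (mul_nonneg ht0 ht1)
    nlinarith [a0, a1, a2, mul_nonneg ht0 ht1]

/-- **Corollary (third event = union of the first two).**  For all increasing `A, B`:  `F(A,B;A ∪ B) ≥ 0`; since
`A ∩ (A∪B) = A` etc. this is Harris' `Cov(A,B) ≥ 0` again — recorded as the consistency check of the class theorem at its top element.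
[this work] -/
theorem F_nonneg_third_eq_union (p : κ → unitInterval) {A B : Set (Set κ)} (hA : IsUpperSet A) (hB : IsUpperSet B) :
    0 ≤ (1 + μ⟦p, A ∪ B⟧) * μ⟦p, A ∩ B ∩ (A ∪ B)⟧ - μ⟦p, A ∪ B⟧ * μ⟦p, A ∩ B⟧ - μ⟦p, A ∩ (A ∪ B)⟧ * μ⟦p, B ∩ (A ∪ B)⟧ :=
  F_nonneg_of_third_subset_union p A B (A ∪ B) hA hB (IsUpperSet.union hA hB) le_rfl

end SahiFInduction

end Summit.CriticalPhenomena.PercolationContinuityZ3.Theorems
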